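import Summits.CriticalPhenomena.PercolationContinuityZ3.Theorems.PercNearOneGluingNoHeavySamePContinuation
import Summits.CriticalPhenomena.PercolationContinuityZ3.Theorems.PercNearOneGluingNoHeavyLowerTailCSHTheoremOne
import Literature.Probability.Percolation.KozmaNitzanTheorem6
import HarnessLib

/-!
# `θ_{ℤ^d}(p_c) = 0` (`d ≥ 3`) by the same-`p` continuation principle — Kozma–Nitzan's Theorem 6
# WITHOUT the slab / half-space input (no Barsky–Grimmett–Newman, no Aizenman–Grimmett, no DCST)

builds on p205010 (kernel theorem, internal audit signed; external expert review pending).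
Lane `prim-bschramm`, seat `prim-bschramm-p4` (class C3, abstract closing argument).  New mathematics
of the lane (a second proof of block (D) of the p205010 chain), not a published statement.

The p205010 chain closes block (D) by: Conjecture 3 + `θ(p) > 0` ⇒ a slab `S_k` percolates at the SAME
`p` (KN §4, `KozmaNitzan2024_slabPercolation_holds`), and `θ_{S_k}(p_c) = 0` (BGN 1991, Grimmett Thm
(7.35), `BarskyGrimmettNewman1991_holds`).  Here the second input is replaced by continuity in `p`:
KN's exploration scheme (`KSch`, `KozmaNitzanScheme.lean`) is a history-driven site-renormalisation
scheme whose probe envelopes are lattice edge sets inside a cube of side `72r + 1` around the source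
cell (`SameP.card_env_le`, from the validity of probed histories and the cell geometry
`Ewv ⊆ Cell ∪ Cell`, `Stub ⊆ Cell ∪ Zone` of `KozmaNitzanSteps.lean`), so the continuation principle
`SameP.criticalProb_lt_of_lawful` applies: a lawful scheme at `p_c` (which KN §4 builds from
`θ(p_c) > 0` with ANY `ε`, here `2⁻³³`, `SameP.exists_KSch_lawful`) would give `p_c < p_c`.

* `SameP.exists_KSch_lawful` — KN §4 (pp. 25–31) with `ε = 2⁻³³`: from the target property at `p`,
  `0 < p < 1`, `θ(p) > 0`, a scheme `S : KSch d` with `S.p = p`, `S.δc ≤ 1`, lawful at `(p, 2⁻³³)`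
  (the constants of `exists_KSch_theta_slab_pos_of_target`, verbatim, one more halving);
* `SameP.envRegion_subset_cube`, `SameP.card_env_le`, `SameP.card_env_le_of_next` — the
  uniform envelope bound `2d(72r + 3)^d`;
* `SameP.percolationContinuity_of_conjecture3` — Conjecture 3 ⇒ `PercolationContinuity d`, `d ≥ 3`,
  through `SameP.criticalProb_lt_of_lawful` (inputs of block (D) used: a.s. uniqueness of the
  infinite cluster via Lemma 7 inside `targetProperty_of_conjecture3`, the box geometry of `ℤ^d`,
  `0 < p_c(ℤ^d) < 1`; NOT used: any slab or half-space theorem);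
* `SameP.percolationContinuity_three_le` — the same fed with the tree's closed theorem
  `CSH.kozmaNitzan_conjecture3_holds` (p205010): a second closed term for `θ_{ℤ^d}(p_c) = 0`, `d ≥ 3`.
[cite: KozmaNitzan2024, §1 p. 2 (approach 1), §4 Theorem 6 (pp. 25–31)]
-/

noncomputable section

namespace Summit.CriticalPhenomena.PercolationContinuityZ3.Theorems

open MeasureTheory ProbabilityTheory Literature.Probability.Percolation Literature.Probability.LatticeModels
open Literature.Probability.Percolation.KozmaNitzan GadgetSystem HSiteScheme SimpleGraph
open scoped ENNReal Classical

namespace SameP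

variable {d : ℕ}

/-! ### Cubes of `ℤ^d` -/

/-- The cube `c + [-u, u]^d` has at most `(2u + 1)^d` points. [folklore] -/
theorem card_cube_le (c : Site d) (u : ℕ) :
    (Finset.Icc (c - (u : Site d)) (c + (u : Site d))).card ≤ (2 * u + 1) ^ d :=
  KozmaNitzan.card_Icc_le_pow fun k => by
    simp only [Pi.add_apply, Pi.sub_apply, Pi.natCast_apply]; omega

/-! ### The uniform envelope bound of Kozma–Nitzan's exploration scheme -/

/-- **The envelope region lies in the cube of radius `35r` around the source centre**: `E_{w,v}` lies in
the cells of `w` and `v`, each stub `H^{K-1}_{v,x}` in the cell of `v` or its stub zone, and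
`cen v = cen w ± 20r e_a`. [cite: KozmaNitzan2024, §4 p. 26 (Q_v, E_{v,x}, H^j_{v,x})] -/
theorem envRegion_subset_cube (S : KSch d) (h : ProbeHistory (Site d)) (e : Site 2 × MDir) :
    S.envRegion h e ⊆ Finset.Icc (S.C.cen e.1 - ((35 * S.C.r : ℕ) : Site d)) (S.C.cen e.1 + ((35 * S.C.r : ℕ) : Site d)) := by
  intro z hz
  rw [KozmaNitzan.mem_cIcc_iff]
  have hcen : ∀ i, |S.C.cen (tgt e) i - S.C.cen e.1 i| ≤ 20 * S.C.r := by
    intro i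
    show |S.C.cen (e.1 + stepVec e.2) i - S.C.cen e.1 i| ≤ _
    rw [S.C.cen_add_stepVec]
    split_ifs
    · rcases Cells.sgOf_sign e.2 with h1 | h1 <;> rw [h1] <;> simp
    · simp
  have hwC : ∀ i, S.C.wC i ≤ 10 * S.C.r := fun i => by
    unfold Cells.wC; split_ifs <;> omega
  have hCell : ∀ v i, z ∈ S.C.Cell v → |z i - S.C.cen v i| ≤ 10 * S.C.r := by
    intro v i hzv
    rw [Cells.Cell, Finset.mem_Icc] at hzv
    have h1 := hzv.1 i
    have h2 := hzv.2 i
    simp only [Pi.sub_apply, Pi.add_apply] at h1 h2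
    have := hwC i
    rw [abs_le]; constructor <;> linarith
  rcases Finset.mem_union.1 hz with hz | hz
  · rcases Finset.mem_union.1 (S.C.Ewv_subset_Cells e.1 e.2 hz) with hz | hz
    · intro i
      have h1 := hCell e.1 i hz
      rw [abs_le] at h1
      push_cast; constructor <;> linarith
    · intro i
      have h1 := hCell _ i hz
      have h2 := hcen i
      change |z i - S.C.cen (tgt e) i| ≤ _ at h1
      rw [abs_le] at h1 h2
      push_cast; constructor <;> linarith
  · obtain ⟨du, -, hz⟩ := Finset.mem_biUnion.1 hz
    have hK : S.C.K - 1 + 1 ≤ S.C.K := by have := S.C.hK; omega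
    rcases Finset.mem_union.1 (S.C.Stub_subset_Cell_union_Zone (tgt e) du hK hz) with hz | hz
    · intro i
      have h1 := hCell _ i hz
      have h2 := hcen i
      rw [abs_le] at h1 h2
      push_cast; constructor <;> linarith
    · intro i
      rw [Cells.Zone, mem_sBox_iff (Cells.sgOf_sign du)] at hz
      obtain ⟨⟨ha1, ha2⟩, hoth⟩ := hz
      have h2 := hcen i
      rw [abs_le] at h2
      have hs : (0 : ℤ) ≤ S.C.s := by positivity
      by_cases hi : i = S.C.axOf du
      · subst hi
        rcases Cells.sgOf_sign du with h1 | h1 <;> rw [h1] at ha1 ha2 <;> push_cast <;>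
          constructor <;> linarith
      · have := hoth i hi
        push_cast; constructor <;> linarith

/-- **After a valid history the envelope of the examination has at most `2d(72r + 3)^d` edges**: the
explored edges are exactly the lattice edges inside the explored region (`Valid.F_eq`), so a fresh edge
of the envelope has an endpoint in the envelope region, hence both endpoints in the cube of radius
`36r`. [cite: KozmaNitzan2024, §4 p. 27 (E_{i+1})] -/
theorem card_env_le (S : KSch d) {h : ProbeHistory (Site d)} {e : Site 2 × MDir} (hV : S.Valid h e) :
    (S.env h e).card ≤ 2 * d * (2 * (36 * S.C.r + 1) + 1) ^ d := by
  have hsub : S.env h e ⊆ edgesIn (zdGraph d)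
      (Finset.Icc (S.C.cen e.1 - ((36 * S.C.r + 1 : ℕ) : Site d)) (S.C.cen e.1 + ((36 * S.C.r + 1 : ℕ) : Site d))) := by
    intro x hx
    rw [KSch.env, Finset.mem_sdiff, hV.F_eq] at hx
    obtain ⟨hx1, hx2⟩ := hx
    rw [mem_edgesIn_iff] at hx1 hx2 ⊢
    refine ⟨hx1.1, ?_⟩
    have hx2' : ∃ z ∈ x, z ∉ S.V h := by
      by_contra hcon
      push Not at hcon
      exact hx2 ⟨hx1.1, hcon⟩
    obtain ⟨z, hz, hzV⟩ := hx2'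
    have hzR : z ∈ S.envRegion h e := (Finset.mem_union.1 (hx1.2 z hz)).resolve_left hzV
    have hzc := envRegion_subset_cube S h e hzR
    rw [KozmaNitzan.mem_cIcc_iff] at hzc
    intro y hy
    rw [KozmaNitzan.mem_cIcc_iff]
    by_cases hyz : y = z
    · subst hyz
      intro i; have := hzc i; push_cast at this ⊢; constructor <;> linarith
    · have hxe : x = s(y, z) := Sym2.eq_of_ne_mem hyz hy hz (Sym2.mem_mk_left y z) (Sym2.mem_mk_right y z)
      rw [hxe, SimpleGraph.mem_edgeSet] at hx1
      -- lattice neighbours differ by at most one in every coordinate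
      have hadj : ∀ j, |z j - y j| ≤ 1 := by
        intro j
        obtain ⟨i, h | h⟩ := (zdGraph_adj_iff y z).1 hx1.1
        · have := congrFun h j
          rw [Pi.add_apply, Pi.single_apply] at this
          split_ifs at this <;> rw [abs_le] <;> constructor <;> linarith
        · have := congrFun h j
          rw [Pi.add_apply, Pi.single_apply] at this
          split_ifs at this <;> rw [abs_le] <;> constructor <;> linarith
      intro i
      have h1 := hadj i
      have h2 := hzc i
      rw [abs_le] at h1
      push_cast at h2 ⊢; constructor <;> linarith
  calc (S.env h e).card
        ≤ (edgesIn (zdGraph d) (Finset.Icc (S.C.cen e.1 - ((36 * S.C.r + 1 : ℕ) : Site d))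
            (S.C.cen e.1 + ((36 * S.C.r + 1 : ℕ) : Site d)))).card := Finset.card_le_card hsub
    _ ≤ 2 * d * (Finset.Icc (S.C.cen e.1 - ((36 * S.C.r + 1 : ℕ) : Site d))
            (S.C.cen e.1 + ((36 * S.C.r + 1 : ℕ) : Site d))).card := KozmaNitzan.card_edgesIn_le _
    _ ≤ 2 * d * (2 * (36 * S.C.r + 1) + 1) ^ d := Nat.mul_le_mul_left _ (card_cube_le _ _)

/-- **Uniform envelope bound along the scheme**: every probe the explorer issues has an envelope of at
most `2d(72r + 3)^d` edges (probes are issued only after valid histories). [cite: KozmaNitzan2024, §4 p. 27] -/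
theorem card_env_le_of_next (S : KSch d) :
    ∀ hh P, S.scheme.E.next hh = some P → P.env.card ≤ 2 * d * (2 * (36 * S.C.r + 1) + 1) ^ d := by
  intro hh P hP
  rw [KSch.scheme_next] at hP
  obtain ⟨e, -, hV, rfl⟩ := S.nextProbe_eq_some hP
  exact card_env_le S hV

/-! ### KN §4 with `ε = 2⁻³³`: a lawful scheme at every percolating density -/

/-- **Kozma–Nitzan's §4 construction, output as a LAWFUL SCHEME** (instead of slab percolation): from
the target property at `p` (Lemma 10), `0 < p < 1` and `θ_{ℤ^d}(p) > 0`, `d ≥ 3`, an exploration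
scheme `S` with `S.p = p`, `S.δc ≤ 1`, lawful at `(p, 2⁻³³)`.  The constants are those of
`exists_KSch_theta_slab_pos_of_target` (KN pp. 25–26) with `ε` halved once more.
[cite: KozmaNitzan2024, §4 Theorem 6 (pp. 25–31)] -/
theorem exists_KSch_lawful [NeZero d] (hd : 3 ≤ d) (p : unitInterval)
    (hT : TargetProperty d p) (hp1 : (p : ℝ) < 1) (hθ : 0 < theta (zdGraph d) (0 : Site d) p) :
    ∃ S : KSch d, S.p = p ∧ S.δc ≤ 1 ∧ S.scheme.Lawful (zdGraph d) p ((1 / 2) ^ 33) := by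
  -- `ε`
  set ε : ℝ := (1 / 2) ^ 33 with hε
  have hε0 : 0 < ε := by positivity
  -- Lemma 12 at `ε / 8`
  obtain ⟨δ, hδ0, m, hcorr⟩ := CData.corridorLemma_of_target p hT hp1 hθ (ε := ε / 8) (by positivity)
  set δc : ℝ := min δ (1 / 2) with hδc
  have hδc0 : 0 < δc := lt_min hδ0 (by norm_num)
  have hδc1 : δc ≤ 1 := (min_le_right _ _).trans (by norm_num)
  have hδcδ : δc ≤ δ := min_le_left _ _
  -- Lemma 10 at `δc`
  obtain ⟨δ₂, hδ₂0, htgt0⟩ := hT hδc0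
  set δ₂' : ℝ := min δ₂ 1 with hδ₂'
  have hδ₂'0 : 0 < δ₂' := lt_min hδ₂0 one_pos
  have hδ₂'1 : δ₂' ≤ 1 := min_le_right _ _
  have hδ₂'2 : δ₂' ≤ δ₂ := min_le_left _ _
  -- `K`
  obtain ⟨K₀, hK₀⟩ := exists_pow_lt_of_lt_one (show 0 < ε / 8 by positivity) (show 1 - δ₂' < 1 by linarith)
  set K : ℕ := max K₀ 20 with hK
  have hK20 : 20 ≤ K := le_max_right _ _
  have hKε : (1 - δ₂') ^ K + ε / 8 ≤ ε / 4 := by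
    have : (1 - δ₂') ^ K ≤ (1 - δ₂') ^ K₀ := pow_le_pow_of_le_one (by linarith) (by linarith) (le_max_left _ _)
    linarith
  -- `R`
  have hK2 : 2 ≤ 2 * K := by omega
  obtain ⟨R, hR⟩ := htgt0 (elongList d (2 * K) (by omega)) (isHittable_of_mem_elongList_of_target p hT hp1 hθ (2 * K) hK2)
  -- the hittability thresholds for (32) at the origin
  set C₀ : Cells d := ⟨hd, 20, 1, le_rfl, le_rfl⟩ with hC₀
  have hhit6 : ∀ du : MDir, ∃ kℓ : ℕ, ∀ m', kℓ ≤ m' → ∀ ℓ, kℓ ≤ ℓ →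
      1 - δc < (bondPercolation (zdGraph d) p).real
        (linkIn (↑((elongGeom (C₀.axOf du) (σu du) 6 (by norm_num)).Qset ℓ 0)) (box d m')
          ((elongGeom (C₀.axOf du) (σu du) 6 (by norm_num)).Fset ℓ 0)) := by
    intro du
    obtain ⟨k, ℓ₀, h⟩ := (isHittable_elongGeom_of_target p hT hp1 hθ (C₀.axOf du) (σu du) 6 (by norm_num)).hit δc hδc0
    exact ⟨max k ℓ₀, fun m' hm' ℓ hℓ => h m' ((le_max_left _ _).trans hm') ℓ ((le_max_right _ _).trans hℓ)⟩
  choose kℓ hkℓ using hhit6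
  set kmax : ℕ := Finset.univ.sup kℓ with hkmax
  have hkmax' : ∀ du, kℓ du ≤ kmax := fun du => Finset.le_sup (f := kℓ) (Finset.mem_univ du)
  -- `s` and the scheme
  set s : ℕ := max (max (max 1 (2 * R)) m) kmax with hs
  have hs1 : 1 ≤ s := le_trans (le_trans (le_max_left _ _) (le_max_left _ _)) (le_max_left _ _)
  have hsR : 2 * R ≤ s := le_trans (le_trans (le_max_right _ _) (le_max_left _ _)) (le_max_left _ _)
  have hsm : m ≤ s := le_trans (le_max_right _ _) (le_max_left _ _)
  have hsk : kmax ≤ s := le_max_right _ _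
  set C : Cells d := ⟨hd, K, s, hK20, hs1⟩ with hCdef
  set S : KSch d := ⟨C, p, δc⟩ with hSdef
  refine ⟨S, rfl, hδc1, ?_⟩
  have hsr : s ≤ C.r := by
    show s ≤ K * s
    exact Nat.le_mul_of_pos_left s (by omega)
  -- lawfulness
  refine S.lawful (fun du => ?_) (fun h e hV => ?_)
  · refine S.hQ0_of_hit du (hkℓ du (3 * C.r) ?_ (3 * C.r) ?_) <;> linarith [hkmax' du]
  · refine KSch.fail_bound hV hε0.le hδ₂'1 (R := R) (fun T hT hTr hyp => ?_)
      (fun W Sfin D lo hi T o h1 h2 h3 h4 h5 h6 h7 h8 h9 h10 => ?_) hsR hKε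
    · refine hcorr T hT ?_ (lt_of_le_of_lt (by show 1 - δ ≤ 1 - S.δc; linarith) hyp)
      rw [hTr]; exact hsm.trans hsr
    · exact hR W Sfin D lo hi T o h1 h2 h3 h4 h5 h6 h7 h8 h9
        (lt_of_le_of_lt (by show 1 - δ₂ ≤ 1 - δ₂'; linarith) h10)

/-! ### `θ_{ℤ^d}(p_c) = 0`, `d ≥ 3`, without any slab or half-space input -/

/-- **Kozma–Nitzan's Theorem 6 for `d ≥ 3` by the continuation principle**: Conjecture 3 implies
`θ_{ℤ^d}(p_c(ℤ^d)) = 0`.  Proof: were `θ(p_c) > 0` (`0 < p_c < 1`), KN §4 would give a lawful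
bounded-range scheme at `p_c` whose infinite macro-cluster forces `0 ↔ ∞`
(`KSch.mem_percolatesVia_of_infinite`), and `SameP.criticalProb_lt_of_lawful` would give
`p_c < p_c`.  No slab / half-space theorem (BGN, Aizenman–Grimmett, DCST) is used.
[cite: KozmaNitzan2024, §1 p. 2 (approach 1), §4 Theorem 6 (pp. 25–31)] -/
theorem percolationContinuity_of_conjecture3 (hC : KozmaNitzan2024_conjecture3) (d : ℕ) (hd : 3 ≤ d) :
    PercolationContinuity d := by
  haveI : NeZero d := ⟨by omega⟩
  unfold PercolationContinuity
  by_contra hne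
  have hpos : 0 < theta (zdGraph d) 0 (criticalProbI d) := lt_of_le_of_ne measureReal_nonneg (Ne.symm hne)
  have hp0 : 0 < ((criticalProbI d : unitInterval) : ℝ) := criticalProb_zd_pos d (by omega)
  have hp1 : ((criticalProbI d : unitInterval) : ℝ) < 1 := criticalProb_zd_lt_one (by omega)
  obtain ⟨S, hSp, hδc, hL⟩ := exists_KSch_lawful hd (criticalProbI d)
    (targetProperty_of_conjecture3 hC _ hp0 hp1 hpos) hp1 hpos
  have hU : (↑S.scheme.U₀ : Set (Sym2 (Site d))) ⊆ (zdGraph d).edgeSet := fun x hx =>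
    (mem_edgesIn_iff.1 (Finset.mem_coe.1 hx)).1
  have hperc : S.scheme.initEvent ∩ {ω | (S.scheme.occFinal ω).Infinite} ⊆
      percolatesAt (0 : Site d) ∪ {ω | ¬ω ⊆ (zdGraph d).edgeSet} := by
    rintro ω ⟨hA, hinf⟩
    by_cases hωE : ω ⊆ (zdGraph d).edgeSet
    · exact Or.inl (percolatesVia_subset_percolatesAt _ _ (S.mem_percolatesVia_of_infinite hδc hωE hA hinf))
    · exact Or.inr hωE
  have hlt := criticalProb_lt_of_lawful hL (by norm_num) (card_env_le_of_next S) hU hp0 hperc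
  exact lt_irrefl _ hlt

/-- **`θ_{ℤ^d}(p_c) = 0` for every `d ≥ 3`, closed term, by the continuation principle** — fed with
the tree's theorem `CSH.kozmaNitzan_conjecture3_holds` (p205010).  A second kernel route to the
conjunct whose block (D) uses a.s. uniqueness and the box geometry only.
[cite: KozmaNitzan2024, §4 Theorem 6 with Conj. 3 (p. 15)] -/
theorem percolationContinuity_three_le (d : ℕ) (hd : 3 ≤ d) : PercolationContinuity d :=
  percolationContinuity_of_conjecture3 CSH.kozmaNitzan_conjecture3_holds d hd

end SameP

end Summit.CriticalPhenomena.PercolationContinuityZ3.Theorems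

end
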